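import Summits.BirchSwinnertonDyer.BirchSwinnertonDyer.Theorems.ClassRecordThreeEulerHalvesAtThreeCartanSupplyCubicHecke
import HarnessLib

/-!
# The cubic Hecke operator, II: path counts and `T² = q` on fibre-sum-zero functions

Helper file `--supports stmt-BirchSwinnertonDyer-23422` (seat `bsd-stepL-tam3-p1` g23, LINE OWNER of crux 23422, line `cartan` v11), serving the registered
stub (SUPPLY) `stub_cartanTorusLatticeSupply` (memo `HOME/tam3-p1/g23/SUPPLY-ROAD-GG1.md` §2), continuing `…CubicHecke`. Counting over `𝔽_q²`
(the Cramer parametrisation `p = αv + βw`, `decomp`, `card_biCube`): `#{y : rel x y ∧ rel y z} = q ∕ 0 ∕ #K` for `z = x` ∕ `z ≠ x` in the fibre of `x`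
over `ℙ¹` ∕ `z` off the fibre (`card_relrel_self ∕ _fibre ∕ _off`), whence **`hecke_hecke_apply`** : `(T²φ)(x) = q·φ(x) + #K · Σ_{z ∉ fibre(x)} φ(z)`
and **`hecke_hecke_of_fibreSumZero`** : `T²φ = q·φ` when all fibre sums of `φ` vanish (the lattice `V₁ = ker(ℤ[X] → ℤ[ℙ¹])`, on which
`S = x̄⁻¹T`, `N(x) = q`, will be the descent involution).
HONEST FRAMING: finite-field bookkeeping; nothing about SUPPLY, NUM, crux 23422 ∕ 19109 is proved here; BSD is proved for no curve. [folklore]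
-/

namespace Summit.BirchSwinnertonDyer.BirchSwinnertonDyer.Theorems.CartanSupply.CubicHecke

open Summit.BirchSwinnertonDyer.BirchSwinnertonDyer.Theorems.CartanDegree
open Summit.BirchSwinnertonDyer.BirchSwinnertonDyer.Theorems.CartanTorusCubeCut
open Summit.BirchSwinnertonDyer.BirchSwinnertonDyer.Theorems.CartanSupply.CubicClasses

set_option linter.dupNamespace false
set_option autoImplicit false

open scoped Classical

variable {q : ℕ} [Fact q.Prime]

/-! ## §5 Fibres over `ℙ¹` and the pairing; the path counts `#{y : rel x y ∧ rel y z}` -/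

/-- PROVED: two classes lie over the same point of `ℙ¹` iff the pairing of representatives vanishes. [folklore] -/
theorem toP1_eq_iff_dt (v w : V0 q) : toP1 (mk w) = toP1 (mk v) ↔ dt (v : Fin 2 → ZMod q) w = 0 := by
  rw [toP1_mk, toP1_mk, Projectivization.mk_eq_mk_iff]
  constructor
  · rintro ⟨u, hu⟩
    rw [← hu]
    show dt (v : Fin 2 → ZMod q) ((u : ZMod q) • (v : Fin 2 → ZMod q)) = 0
    rw [dt_smul_right]; unfold dt; ring
  · intro h
    obtain ⟨c, hc⟩ := CubicPointsFixed.eq_smul_of_collinear v.2 (sub_eq_zero.mp h)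
    have hc0 : c ≠ 0 := by rintro rfl; exact w.2 (by rw [hc, zero_smul])
    exact ⟨Units.mk0 c hc0, by rw [hc]; rfl⟩

/-- PROVED: `#{y : rel x y ∧ rel y x} = q`. [folklore] -/
theorem card_relrel_self (x : X q) : (Finset.univ.filter fun y : X q => rel x y ∧ rel y x).card = q := by
  have h : (Finset.univ.filter fun y : X q => rel x y ∧ rel y x) = Finset.univ.filter fun y : X q => rel x y :=
    Finset.filter_congr fun y _ => ⟨fun h => h.1, fun h => ⟨h, (rel_symm x y).mp h⟩⟩
  rw [h]
  exact card_rel_eq x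

/-- PROVED: no two-step path from `x` to another point of its own fibre. [folklore] -/
theorem card_relrel_fibre {x z : X q} (hz : toP1 z = toP1 x) (hne : z ≠ x) :
    (Finset.univ.filter fun y : X q => rel x y ∧ rel y z).card = 0 := by
  obtain ⟨u, rfl⟩ := (toP1_eq_toP1_iff x z).mp hz
  have hu : u ∉ cubes q := fun hu => hne (by rw [ρX_of_mem hu, Equiv.Perm.one_apply])
  rw [Finset.card_eq_zero, Finset.filter_eq_empty_iff]
  rintro y - ⟨h1, h2⟩
  apply hu
  -- `rel y (ρ_u x) ↔ rel (ρ_u y) x ↔ rel x (ρ_u y)`: with `rel x y` this forces `u ∈ K`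
  rw [rel_symm, rel_ρX, rel_symm] at h2
  obtain ⟨v, rfl⟩ := mk_surjective x
  obtain ⟨w, rfl⟩ := mk_surjective y
  rw [rel_mk] at h1
  rw [rel_symm, ρX_mk, rel_mk, coe_scaleV, dt_smul_right, mul_comm, isCubeUnit_mul_iff h1] at h2
  exact (mem_cubes_iff_isCubeUnit u).mpr h2

/-- PROVED: Cramer decomposition `p = (det(p|w)/D) v + (det(v|p)/D) w`, `D = det(v|w) ≠ 0`. [folklore] -/
theorem decomp {v w : Fin 2 → ZMod q} (hD : dt v w ≠ 0) (p : Fin 2 → ZMod q) :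
    p = (dt p w * (dt v w)⁻¹) • v + (dt v p * (dt v w)⁻¹) • w := by
  have k0 : dt p w * v 0 + dt v p * w 0 = p 0 * dt v w := by unfold dt; ring
  have k1 : dt p w * v 1 + dt v p * w 1 = p 1 * dt v w := by unfold dt; ring
  ext i
  fin_cases i
  · show p 0 = dt p w * (dt v w)⁻¹ * v 0 + dt v p * (dt v w)⁻¹ * w 0
    rw [show dt p w * (dt v w)⁻¹ * v 0 + dt v p * (dt v w)⁻¹ * w 0 = (dt p w * v 0 + dt v p * w 0) * (dt v w)⁻¹ by ring,
      k0, mul_assoc, mul_inv_cancel₀ hD, mul_one]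
  · show p 1 = dt p w * (dt v w)⁻¹ * v 1 + dt v p * (dt v w)⁻¹ * w 1
    rw [show dt p w * (dt v w)⁻¹ * v 1 + dt v p * (dt v w)⁻¹ * w 1 = (dt p w * v 1 + dt v p * w 1) * (dt v w)⁻¹ by ring,
      k1, mul_assoc, mul_inv_cancel₀ hD, mul_one]

/-- PROVED: for independent `v, w` (`D = det(v|w) ≠ 0`), `#{p : det(v|p) ∈ K ∧ det(p|w) ∈ K} = #K²`. [folklore] -/
theorem card_biCube {v w : Fin 2 → ZMod q} (hD : dt v w ≠ 0) :
    (Finset.univ.filter fun p : Fin 2 → ZMod q => IsCubeUnit (dt v p) ∧ IsCubeUnit (dt p w)).card =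
      Nat.card (cubes q) * Nat.card (cubes q) := by
  rw [← card_cubeUnits_mul hD, ← Finset.card_product, ← Finset.filter_product]
  symm
  refine Finset.card_bij (fun ab _ => ab.2 • v + ab.1 • w) (fun ab hab => ?_) (fun ab _ ab' _ h => ?_) (fun p hp => ?_)
  · simp only [Finset.mem_filter, Finset.mem_product, Finset.mem_univ, true_and] at hab ⊢
    rw [dt_combo_right, dt_combo_left]
    exact ⟨hab.1, hab.2⟩
  · have h1 := congrArg (fun p => dt v p) h
    have h2 := congrArg (fun p => dt p w) h
    simp only [dt_combo_right, dt_combo_left] at h1 h2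
    exact Prod.ext (mul_right_cancel₀ hD h1) (mul_right_cancel₀ hD h2)
  · simp only [Finset.mem_filter, Finset.mem_univ, true_and] at hp
    refine ⟨(dt v p * (dt v w)⁻¹, dt p w * (dt v w)⁻¹), ?_, ?_⟩
    · simp only [Finset.mem_filter, Finset.mem_product, Finset.mem_univ, true_and, mul_assoc, inv_mul_cancel₀ hD, mul_one]
      exact hp
    · exact (decomp hD p).symm

/-- PROVED: off the fibre there are exactly `#K` two-step paths. [folklore] -/
theorem card_relrel_off {x z : X q} (hz : toP1 z ≠ toP1 x) :
    (Finset.univ.filter fun y : X q => rel x y ∧ rel y z).card = Nat.card (cubes q) := by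
  obtain ⟨v, rfl⟩ := mk_surjective x
  obtain ⟨w, rfl⟩ := mk_surjective z
  have hD : dt (v : Fin 2 → ZMod q) w ≠ 0 := fun h => hz ((toP1_eq_iff_dt v w).mpr h)
  have hK : 0 < Nat.card (cubes q) := Nat.card_pos
  apply Nat.eq_of_mul_eq_mul_left hK
  have step : Nat.card (cubes q) * (Finset.univ.filter fun y : X q => rel (mk v) y ∧ rel y (mk w)).card =
      (Finset.univ.filter fun p : V0 q => rel (mk v) (mk p) ∧ rel (mk p) (mk w)).card := by
    convert (card_filter_V0_eq (q := q) (fun y => rel (mk v) y ∧ rel y (mk w))).symm using 3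
    congr 1
  rw [step]
  have h1 : (Finset.univ.filter fun p : V0 q => rel (mk v) (mk p) ∧ rel (mk p) (mk w)) =
      Finset.univ.filter fun p : V0 q => IsCubeUnit (dt (v : Fin 2 → ZMod q) p) ∧ IsCubeUnit (dt (p : Fin 2 → ZMod q) w) :=
    Finset.filter_congr (fun p _ => by rw [rel_mk, rel_mk])
  have h2 : (Finset.univ.filter fun p : Fin 2 → ZMod q => p ≠ 0 ∧ (IsCubeUnit (dt (v : Fin 2 → ZMod q) p) ∧ IsCubeUnit (dt p w))) =
      Finset.univ.filter fun p : Fin 2 → ZMod q => IsCubeUnit (dt (v : Fin 2 → ZMod q) p) ∧ IsCubeUnit (dt p w) := by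
    apply Finset.filter_congr
    intro p _
    refine ⟨fun h => h.2, fun h => ⟨?_, h⟩⟩
    rintro rfl
    apply h.1.ne_zero
    unfold dt; simp
  have step2 : (Finset.univ.filter fun p : V0 q =>
        IsCubeUnit (dt (v : Fin 2 → ZMod q) p) ∧ IsCubeUnit (dt (p : Fin 2 → ZMod q) w)).card =
      (Finset.univ.filter fun p : Fin 2 → ZMod q => p ≠ 0 ∧ (IsCubeUnit (dt (v : Fin 2 → ZMod q) p) ∧ IsCubeUnit (dt p w))).card := by
    convert (card_filter_ne_zero_eq (q := q) (fun p => IsCubeUnit (dt (v : Fin 2 → ZMod q) p) ∧ IsCubeUnit (dt p w))).symm using 3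
  rw [h1, step2, h2, card_biCube hD]

/-! ## §6 `T²` -/

section square
variable (A : Type*) [CommRing A]

/-- PROVED: `(T²φ)(x) = Σ_z #{y : rel x y ∧ rel y z} · φ(z)`. [folklore] -/
theorem hecke_hecke_apply_sum (φ : X q → A) (x : X q) :
    hecke A (hecke A φ) x = ∑ z, ((Finset.univ.filter fun y : X q => rel x y ∧ rel y z).card : A) * φ z := by
  rw [hecke_apply]
  simp_rw [hecke_apply]
  have h1 : ∀ y : X q, (if rel x y then ∑ z, (if rel y z then φ z else 0) else 0) =
      ∑ z, (if rel x y ∧ rel y z then φ z else 0) := by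
    intro y
    by_cases hy : rel x y
    · simp only [hy, if_true, true_and]
    · simp only [hy, if_false, false_and]; simp
  simp_rw [h1]
  rw [Finset.sum_comm]
  refine Finset.sum_congr rfl fun z _ => ?_
  rw [Finset.card_eq_sum_ones, Nat.cast_sum, Finset.sum_mul, Finset.sum_filter]
  refine Finset.sum_congr rfl fun y _ => ?_
  split_ifs <;> simp

/-- PROVED — **`(T²φ)(x) = q·φ(x) + #K · Σ_{z off the fibre of x} φ(z)`**. [folklore] -/
theorem hecke_hecke_apply (φ : X q → A) (x : X q) :
    hecke A (hecke A φ) x = (q : A) * φ x +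
      (Nat.card (cubes q) : A) * ∑ z ∈ Finset.univ.filter (fun z : X q => toP1 z ≠ toP1 x), φ z := by
  rw [hecke_hecke_apply_sum, ← Finset.sum_filter_add_sum_filter_not Finset.univ (fun z : X q => toP1 z = toP1 x)]
  congr 1
  · rw [Finset.sum_eq_single_of_mem x (by simp)]
    · rw [card_relrel_self]
    · intro z hz hzx
      simp only [Finset.mem_filter, Finset.mem_univ, true_and] at hz
      rw [card_relrel_fibre hz hzx, Nat.cast_zero, zero_mul]
  · rw [Finset.mul_sum]
    refine Finset.sum_congr rfl fun z hz => ?_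
    simp only [Finset.mem_filter, Finset.mem_univ, true_and] at hz
    rw [card_relrel_off hz]

/-- PROVED — **`T² = q` ON FIBRE-SUM-ZERO FUNCTIONS** (the lattice `V₁ = ker(ℤ[X] → ℤ[ℙ¹])`). [folklore] -/
theorem hecke_hecke_of_fibreSumZero (φ : X q → A)
    (hφ : ∀ p : Steinberg.P1 q, ∑ z ∈ Finset.univ.filter (fun z : X q => toP1 z = p), φ z = 0) :
    hecke A (hecke A φ) = (q : A) • φ := by
  funext x
  rw [hecke_hecke_apply, Pi.smul_apply, smul_eq_mul]
  have hall : ∑ z : X q, φ z = 0 := by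
    rw [← Finset.sum_fiberwise_of_maps_to (s := Finset.univ) (t := Finset.univ.image (toP1 : X q → Steinberg.P1 q))
      (g := fun z : X q => toP1 z) (fun z hz => Finset.mem_image_of_mem _ hz)]
    exact Finset.sum_eq_zero fun p _ => hφ p
  have hoff : ∑ z ∈ Finset.univ.filter (fun z : X q => toP1 z ≠ toP1 x), φ z = 0 := by
    have := Finset.sum_filter_add_sum_filter_not Finset.univ (fun z : X q => toP1 z = toP1 x) φ
    rw [hall, hφ (toP1 x), zero_add] at this
    exact this
  rw [hoff, mul_zero, add_zero]

end square

end Summit.BirchSwinnertonDyer.BirchSwinnertonDyer.Theorems.CartanSupply.CubicHecke
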